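import Summits.KontsevichZagierPeriods.KontsevichZagierPeriods.Theorems.LinRedNormalFormArrangementNormalFormSeparateThreeHHKCover

/-!
# Covering a punctured neighbourhood of a base point of `ℝ³` by finitely many cones

(Line `janus-bands`, crux `ArrangementNormalForm`, stub `stub_separateHigh`, part `HHKCoverB` of
the wall-invariant termwise-split lemma `separateThree_hHk` in base dimension `3` with fibres.)
The second globalisation step of the local analysis at a base point `z₁ ∈ ℝ³`: if for EVERY unit
direction `d` (sup norm) there is a frame `d, A, B` of `ℝ³` such that a measure `ν` is finite on
the cone `SepHHK.dcone z₁ d A B δt δ'` (part `HHKCover`) for some `δ', δt > 0`, and `ν {z₁} = 0`,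
then `ν` is finite on a neighbourhood of `z₁` (`nhds_finite`, registered as
`separateThreeHHK_coverB`). Proof: the frame coordinates `coords d A B x = (fmat d A B)⁻¹ x`
turn each cone into an open cone of directions `{0 < y₀, |y₁| < δ' y₀, |y₂| < δ' y₀}` containing
`d`; the unit sphere is compact, so finitely many of them cover all directions, and a small ball
around `z₁` is covered by `{z₁}` and finitely many cones. Also: lines are Lebesgue-null
(`volume_dline`), for the ray hypothesis of `SepHHK.cone_finite`.
-/

noncomputable section

open Set MeasureTheory Filter Topology Module
open scoped ENNReal

namespace Summit.KontsevichZagierPeriods.ArrangementNormalForm.JanusBands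

namespace SepHHK

open SepTwo

/-! ### Lines are null -/

/-- A line in `ℝ³` is Lebesgue-null. -/
theorem volume_dline (z₁ d : Fin 3 → ℝ) : volume (dline z₁ d) = 0 := by
  set L : Submodule ℝ (Fin 3 → ℝ) := Submodule.span ℝ {d} with hL
  have hLtop : L ≠ ⊤ := by
    intro htop
    have h1 : finrank ℝ L ≤ 1 := by
      have h := finrank_span_le_card (R := ℝ) ({d} : Set (Fin 3 → ℝ))
      rw [Set.toFinset_singleton, Finset.card_singleton] at h
      exact h
    have h2 : finrank ℝ L = 3 := by
      rw [htop, finrank_top, finrank_fintype_fun_eq_card, Fintype.card_fin]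
    omega
  have hsub : dline z₁ d ⊆ (fun z => z + -z₁) ⁻¹' (L : Set (Fin 3 → ℝ)) := by
    rintro z ⟨t, rfl⟩
    simp only [mem_preimage, SetLike.mem_coe, add_neg_cancel_comm]
    exact Submodule.smul_mem _ _ (Submodule.subset_span rfl)
  refine le_antisymm ?_ zero_le
  calc volume (dline z₁ d) ≤ volume ((fun z => z + -z₁) ⁻¹' (L : Set (Fin 3 → ℝ))) := measure_mono hsub
    _ = volume (L : Set (Fin 3 → ℝ)) := measure_preimage_add_right _ _ _
    _ = 0 := Measure.addHaar_submodule volume L hLtop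

/-! ### Frame coordinates -/

/-- The coordinates of `x` in the frame `d, A, B`. -/
def coords (d A B x : Fin 3 → ℝ) : Fin 3 → ℝ := (fmat d A B)⁻¹.mulVec x

/-- The coordinates are continuous. -/
theorem continuous_coords (d A B : Fin 3 → ℝ) : Continuous (coords d A B) := by
  have h : coords d A B = fun x => Matrix.toLin' (fmat d A B)⁻¹ x := by
    funext x; rw [Matrix.toLin'_apply]; rfl
  rw [h]
  exact LinearMap.continuous_of_finiteDimensional _

/-- The coordinates are linear. -/
theorem coords_smul (d A B : Fin 3 → ℝ) (c : ℝ) (x : Fin 3 → ℝ) :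
    coords d A B (c • x) = c • coords d A B x := by
  unfold coords; rw [Matrix.mulVec_smul]

/-- Reconstruction from the coordinates. -/
theorem fmat_mulVec_coords {d A B : Fin 3 → ℝ} (hdet : det3 d A B ≠ 0) (x : Fin 3 → ℝ) :
    (fmat d A B).mulVec (coords d A B x) = x := by
  unfold coords
  rw [Matrix.mulVec_mulVec, Matrix.mul_nonsing_inv _ (isUnit_iff_ne_zero.2 hdet), Matrix.one_mulVec]

/-- Reconstruction from the coordinates, in vector form. -/
theorem eq_of_coords {d A B : Fin 3 → ℝ} (hdet : det3 d A B ≠ 0) (x : Fin 3 → ℝ) :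
    x = coords d A B x 0 • d + coords d A B x 1 • A + coords d A B x 2 • B := by
  conv_lhs => rw [← fmat_mulVec_coords hdet x]
  funext k
  rw [fmat_mulVec]
  simp only [Pi.add_apply, Pi.smul_apply, smul_eq_mul]
  ring

/-- The coordinates of a frame combination. -/
theorem coords_combo {d A B : Fin 3 → ℝ} (hdet : det3 d A B ≠ 0) (y : Fin 3 → ℝ) :
    coords d A B (y 0 • d + y 1 • A + y 2 • B) = y := by
  have h : y 0 • d + y 1 • A + y 2 • B = (fmat d A B).mulVec y := by
    funext k
    rw [fmat_mulVec]
    simp only [Pi.add_apply, Pi.smul_apply, smul_eq_mul]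
    ring
  rw [h, coords, Matrix.mulVec_mulVec, Matrix.nonsing_inv_mul _ (isUnit_iff_ne_zero.2 hdet),
    Matrix.one_mulVec]

/-- The coordinates of the direction itself. -/
theorem coords_self {d A B : Fin 3 → ℝ} (hdet : det3 d A B ≠ 0) : coords d A B d = ![1, 0, 0] := by
  have h := coords_combo hdet ![1, 0, 0]
  simp only [Matrix.cons_val_zero, Matrix.cons_val_one, Matrix.cons_val_two, Matrix.head_cons,
    Matrix.tail_cons, one_smul, zero_smul, add_zero] at h
  exact h

/-! ### The open cone of directions -/

/-- The open cone of directions `{0 < y₀, |y₁| < δ' y₀, |y₂| < δ' y₀}` in frame coordinates. -/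
def ocone (d A B : Fin 3 → ℝ) (δ' : ℝ) : Set (Fin 3 → ℝ) :=
  {x | 0 < coords d A B x 0 ∧ |coords d A B x 1| < δ' * coords d A B x 0 ∧
    |coords d A B x 2| < δ' * coords d A B x 0}

/-- The open cone is open. -/
theorem isOpen_ocone (d A B : Fin 3 → ℝ) (δ' : ℝ) : IsOpen (ocone d A B δ') := by
  have hc : ∀ k, Continuous fun x => coords d A B x k := fun k =>
    (continuous_apply k).comp (continuous_coords d A B)
  refine (isOpen_lt continuous_const (hc 0)).inter ((isOpen_lt ((hc 1).abs)
    (continuous_const.mul (hc 0))).inter (isOpen_lt ((hc 2).abs) (continuous_const.mul (hc 0))))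

/-- The direction lies in its open cone. -/
theorem self_mem_ocone {d A B : Fin 3 → ℝ} (hdet : det3 d A B ≠ 0) {δ' : ℝ} (hδ' : 0 < δ') :
    d ∈ ocone d A B δ' := by
  simp only [ocone, mem_setOf_eq, coords_self hdet, Matrix.cons_val_zero, Matrix.cons_val_one,
    Matrix.cons_val_two, Matrix.head_cons, Matrix.tail_cons, abs_zero, mul_one]
  exact ⟨one_pos, hδ', hδ'⟩

/-- The open cone is a cone. -/
theorem smul_mem_ocone {d A B : Fin 3 → ℝ} {δ' : ℝ} {x : Fin 3 → ℝ} (hx : x ∈ ocone d A B δ')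
    {c : ℝ} (hc : 0 < c) : c • x ∈ ocone d A B δ' := by
  obtain ⟨h0, h1, h2⟩ := hx
  simp only [ocone, mem_setOf_eq, coords_smul, Pi.smul_apply, smul_eq_mul, abs_mul, abs_of_pos hc]
  refine ⟨mul_pos hc h0, ?_, ?_⟩ <;> nlinarith

/-- A point of the open cone with small first coordinate lies in the cone over the planar
neighbourhood. -/
theorem mem_dcone_of_mem_ocone (z₁ : Fin 3 → ℝ) {d A B : Fin 3 → ℝ} (hdet : det3 d A B ≠ 0)
    {δ' δt : ℝ} {x : Fin 3 → ℝ} (hx : x ∈ ocone d A B δ') (ht : coords d A B x 0 < δt) :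
    z₁ + x ∈ dcone z₁ d A B δt δ' := by
  obtain ⟨h0, h1, h2⟩ := hx
  set y := coords d A B x with hy
  refine ⟨y 0, ⟨h0, ht⟩, ![y 1 / y 0, y 2 / y 0], ?_, ?_, ?_⟩
  · simp only [Matrix.cons_val_zero]
    rw [abs_div, abs_of_pos h0, div_lt_iff₀ h0]; exact h1
  · show |y 2 / y 0| < δ'
    rw [abs_div, abs_of_pos h0, div_lt_iff₀ h0]; exact h2
  · rw [add_right_inj, emb_vec, smul_add, smul_add, smul_smul, smul_smul,
      mul_div_cancel₀ _ h0.ne', mul_div_cancel₀ _ h0.ne', ← add_assoc]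
    exact eq_of_coords hdet x

/-! ### The neighbourhood -/

/-- A bound for the first frame coordinate by the norm. -/
theorem exists_coords_bound (d A B : Fin 3 → ℝ) : ∃ Cψ : ℝ, 0 < Cψ ∧ ∀ x : Fin 3 → ℝ,
    coords d A B x 0 ≤ Cψ * ‖x‖ := by
  set f : (Fin 3 → ℝ) →ₗ[ℝ] ℝ := (LinearMap.proj 0).comp (Matrix.toLin' (fmat d A B)⁻¹) with hf
  set fc := LinearMap.toContinuousLinearMap f with hfc
  refine ⟨‖fc‖ + 1, by positivity, fun x => ?_⟩
  have h1 : coords d A B x 0 = fc x := by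
    simp only [hfc, hf, LinearMap.coe_toContinuousLinearMap', LinearMap.coe_comp,
      Function.comp_apply, Matrix.toLin'_apply, LinearMap.coe_proj, Function.eval]
    rfl
  rw [h1]
  calc fc x ≤ |fc x| := le_abs_self _
    _ ≤ ‖fc‖ * ‖x‖ := by rw [← Real.norm_eq_abs]; exact fc.le_opNorm x
    _ ≤ (‖fc‖ + 1) * ‖x‖ := by nlinarith [norm_nonneg fc, norm_nonneg x]

/-- **Finiteness on a neighbourhood from finiteness on cones of all directions.** See the module
docstring. -/
theorem nhds_finite (ν : Measure (Fin 3 → ℝ)) (z₁ : Fin 3 → ℝ) (hν : ν {z₁} = 0)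
    (hcone : ∀ d : Fin 3 → ℝ, ‖d‖ = 1 → ∃ A B : Fin 3 → ℝ, det3 d A B ≠ 0 ∧
      ∃ δ' > 0, ∃ δt > 0, ν (dcone z₁ d A B δt δ') < ∞) :
    ∃ V : Set (Fin 3 → ℝ), IsOpen V ∧ z₁ ∈ V ∧ ν V < ∞ := by
  classical
  choose A B hdet δ' hδ' δt hδt hfin using hcone
  set Sph : Set (Fin 3 → ℝ) := Metric.sphere 0 1 with hSph
  have hScomp : IsCompact Sph := isCompact_sphere 0 1
  have hn : ∀ e : Sph, ‖(e : Fin 3 → ℝ)‖ = 1 := fun e => mem_sphere_zero_iff_norm.1 e.2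
  -- open cones of all unit directions cover the sphere
  have hcov : Sph ⊆ ⋃ e : Sph, ocone e.1 (A e.1 (hn e))
      (B e.1 (hn e)) (δ' e.1 (hn e)) := by
    intro x hx
    refine mem_iUnion.2 ⟨⟨x, hx⟩, ?_⟩
    exact self_mem_ocone (hdet x (mem_sphere_zero_iff_norm.1 hx)) (hδ' x (mem_sphere_zero_iff_norm.1 hx))
  obtain ⟨T, hT⟩ := hScomp.elim_finite_subcover _ (fun e => isOpen_ocone _ _ _ _) hcov
  -- the norm bounds and the radius
  have hC : ∀ e : Sph, ∃ Cψ : ℝ, 0 < Cψ ∧ ∀ x : Fin 3 → ℝ,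
      coords e.1 (A e.1 (hn e)) (B e.1 (hn e)) x 0 ≤
        Cψ * ‖x‖ := fun e => exists_coords_bound _ _ _
  choose Cψ hCψ hCψb using hC
  obtain ⟨r, hr, hrle⟩ := exists_pos_le_finset T
    (fun e => δt e.1 (hn e) / Cψ e)
    fun e _ => div_pos (hδt _ _) (hCψ e)
  set V : Set (Fin 3 → ℝ) := Metric.ball z₁ r with hV
  set Cones : Set (Fin 3 → ℝ) := ⋃ e ∈ T, dcone z₁ e.1 (A e.1 (hn e))
    (B e.1 (hn e)) (δt e.1 (hn e))
    (δ' e.1 (hn e)) with hCones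
  have hConesfin : ν Cones < ∞ :=
    measure_biUnion_lt_top T.finite_toSet fun e _ => hfin _ _
  have hsub : V ⊆ {z₁} ∪ Cones := by
    intro z hz
    by_cases hz1 : z = z₁
    · exact Or.inl hz1
    refine Or.inr ?_
    set x := z - z₁ with hx
    have hx0 : x ≠ 0 := sub_ne_zero.2 hz1
    have hxn : 0 < ‖x‖ := norm_pos_iff.2 hx0
    have hxr : ‖x‖ < r := by rwa [hV, Metric.mem_ball, dist_eq_norm] at hz
    -- the unit direction of `x`
    set e : Fin 3 → ℝ := ‖x‖⁻¹ • x with he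
    have heS : e ∈ Sph := by
      rw [hSph, mem_sphere_zero_iff_norm, he, norm_smul, norm_inv, norm_norm, inv_mul_cancel₀ hxn.ne']
    obtain ⟨e', he'⟩ := mem_iUnion.1 (hT heS)
    obtain ⟨he'T, hemem⟩ := mem_iUnion.1 he'
    have hxmem : x ∈ ocone e'.1 (A e'.1 (hn e'))
        (B e'.1 (hn e')) (δ' e'.1 (hn e')) := by
      have h := smul_mem_ocone hemem hxn
      rwa [he, smul_smul, mul_inv_cancel₀ hxn.ne', one_smul] at h
    have ht : coords e'.1 (A e'.1 (hn e')) (B e'.1 (hn e'))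
        x 0 < δt e'.1 (hn e') := by
      calc _ ≤ Cψ e' * ‖x‖ := hCψb e' x
        _ < Cψ e' * r := mul_lt_mul_of_pos_left hxr (hCψ e')
        _ ≤ Cψ e' * (δt e'.1 (hn e') / Cψ e') :=
            mul_le_mul_of_nonneg_left (hrle e' he'T) (hCψ e').le
        _ = δt e'.1 (hn e') := mul_div_cancel₀ _ (hCψ e').ne'
    rw [hCones]
    refine mem_iUnion₂.2 ⟨e', he'T, ?_⟩
    have h := mem_dcone_of_mem_ocone z₁ (hdet _ _) hxmem ht
    rwa [hx, add_sub_cancel] at h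
  refine ⟨V, Metric.isOpen_ball, Metric.mem_ball_self hr, ?_⟩
  calc ν V ≤ ν ({z₁} ∪ Cones) := measure_mono hsub
    _ < ∞ := measure_union_lt_top (hν.trans_lt ENNReal.zero_lt_top) hConesfin

end SepHHK

/-- **Finiteness of a measure near a point from finiteness on cones of all directions**
(registered part of `stub_separateHigh`, base dimension `3` with fibres; literal form of
`SepHHK.nhds_finite`): a measure on `ℝ³` with `ν {z₁} = 0` which, for every unit direction `d`
(sup norm), is finite on a cone `{z₁ + t (d + w₀ A + w₁ B) | t ∈ (0, δt), |w₀|, |w₁| < δ'}` over some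
frame `d, A, B`, is finite on a neighbourhood of `z₁`. -/
theorem separateThreeHHK_coverB (ν : MeasureTheory.Measure (Fin 3 → ℝ)) (z₁ : Fin 3 → ℝ) (hν : ν {z₁} = 0) (hcone : ∀ d : Fin 3 → ℝ, ‖d‖ = 1 → ∃ A B : Fin 3 → ℝ, SepHHK.det3 d A B ≠ 0 ∧ ∃ δ' > 0, ∃ δt > 0, ν {z | ∃ t ∈ Set.Ioo (0 : ℝ) δt, ∃ w : Fin 2 → ℝ, |w 0| < δ' ∧ |w 1| < δ' ∧ z = z₁ + t • (d + (w 0 • A + w 1 • B))} < ⊤) : ∃ V : Set (Fin 3 → ℝ), IsOpen V ∧ z₁ ∈ V ∧ ν V < ⊤ := by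
  exact SepHHK.nhds_finite ν z₁ hν hcone

end Summit.KontsevichZagierPeriods.ArrangementNormalForm.JanusBands
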